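import Mathlib
import HarnessLib
import Literature.MathematicalPhysics.QuantumLattice.FermiRG.BGM2003Sectors
import Summits.HubbardSuperconductivity.HubbardSuperconductivity.Theorems.KLProgrammeAbsUmklappClassCount

/-!
# Route `KLProgramme` — K3 engine (stmt-HubbardSuperconductivity-20437), stub (b) (ℓ)/(I2)–(I3), located item «ABS-UMK-COUNT»:
# the NARROW-BUNDLE COUNT — target strings whose free legs are pairwise within pair angle `Φ₀` number `≤ 2L⁴ · T_bound · N · K₀^{L−5}`

Cell gate-hubbard-kl, seat p4 g15 (route HOME/prover-p4/UV-REMEASURE-COUNT.md §5, the narrow half; the wide half is `BGM2003.count_target_wide`).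
Every narrow string (all free legs pairwise within pair angle `Φ₀`; `L ≥ 6`, so at least five free legs) belongs to one of the classes of
`card_narrowClass_le`: by a pigeonhole on the sides of a reference free leg there are a base free leg `s`, a kept triple `a, b, c` of free legs and a
shift `σ ∈ {0, π}` with the triple within torus distance `2Φ₀` of `θ_s + σ` (`exists_base_triple`).  Summing the class bound over the `≤ L⁴` ordered
quadruples and the two shifts:

* `torusDist_sub_sub_le` — torus triangle inequality; `triple_near_base`, **`exists_base_triple`** — coverage;
* **`card_narrowStrings_le`** — `#{narrow target strings anchored at ω₁} ≤ 2·L⁴ · T_bound · N · K₀^{L−5}` (the `(L−3)` law, `N = 2^{n′+1}`).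

Everything is PROVED; no definitions, no named facts. [cite: BenfattoGiulianiMastropietro2003, §7.4 (s1.21)–(s1.25a) p.28 (L19–52)]
-/

noncomputable section

open Real Set
open Literature.MathematicalPhysics.QuantumLattice Literature.MathematicalPhysics.QuantumLattice.FermiRG
open Literature.MathematicalPhysics.QuantumLattice.FermiRG.BGM2003
open Summit.HubbardSuperconductivity.HubbardSuperconductivity.Theorems.ThinLevelSet
open Summit.HubbardSuperconductivity.HubbardSuperconductivity.Theorems

namespace Summit.HubbardSuperconductivity.HubbardSuperconductivity.Theorems.AbsUmklappCount

set_option linter.dupNamespace false -- summit = problem name (single-conjunct summit), D-0017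

/-! ## §1 Coverage of the narrow strings by the classes -/

/-- `‖(p − c) − (q − c)‖`-type triangle inequality: `‖x − y‖_{𝕋¹} ≤ ‖x − c‖_{𝕋¹} + ‖y − c‖_{𝕋¹}`. [folklore] -/
theorem torusDist_sub_sub_le (x y c : ℝ) : FermiRG.torusDist (x - y) ≤ FermiRG.torusDist (x - c) + FermiRG.torusDist (y - c) := by
  have e : x - y = (x - c) + (-(y - c)) := by ring
  have hneg : FermiRG.torusDist (-(y - c)) = FermiRG.torusDist (y - c) := by unfold FermiRG.torusDist; rw [AddCircle.coe_neg, norm_neg]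
  have hadd : FermiRG.torusDist ((x - c) + (-(y - c))) ≤ FermiRG.torusDist (x - c) + FermiRG.torusDist (-(y - c)) := by
    unfold FermiRG.torusDist; rw [AddCircle.coe_add]; exact norm_add_le _ _
  rw [e]
  exact hadd.trans (by rw [hneg])

/-- Three legs near a common centre and a base point near the same centre: the legs are within twice the radius of the base point. [folklore] -/
theorem triple_near_base {L : ℕ} {T : Finset (Fin L)} (θ : Fin L → ℝ) {c₀ Φ₀ σ : ℝ} {s : Fin L} (hT : 2 < T.card)
    (hTc : ∀ i ∈ T, FermiRG.torusDist (θ i - c₀) ≤ Φ₀) (hs : FermiRG.torusDist (θ s + σ - c₀) ≤ Φ₀) (hsT : s ∉ T) :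
    ∃ a b c : Fin L, a ∈ T ∧ b ∈ T ∧ c ∈ T ∧ s ≠ a ∧ s ≠ b ∧ s ≠ c ∧ a ≠ b ∧ a ≠ c ∧ b ≠ c ∧
      ∀ x ∈ ({a, b, c} : Finset (Fin L)), FermiRG.torusDist (θ x - (θ s + σ)) ≤ 2 * Φ₀ := by
  obtain ⟨a, b, c, ha, hb, hc, hab, hac, hbc⟩ := Finset.two_lt_card_iff.1 hT
  refine ⟨a, b, c, ha, hb, hc, fun h => hsT (h ▸ ha), fun h => hsT (h ▸ hb), fun h => hsT (h ▸ hc), hab, hac, hbc, ?_⟩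
  intro x hx
  have hxT : x ∈ T := by
    simp only [Finset.mem_insert, Finset.mem_singleton] at hx
    rcases hx with rfl | rfl | rfl <;> assumption
  calc FermiRG.torusDist (θ x - (θ s + σ)) ≤ FermiRG.torusDist (θ x - c₀) + FermiRG.torusDist (θ s + σ - c₀) := torusDist_sub_sub_le _ _ _
    _ ≤ Φ₀ + Φ₀ := add_le_add (hTc x hxT) hs
    _ = 2 * Φ₀ := by ring

open Classical in
/-- **Coverage**: if all legs `≠ i₁` of a string with `L ≥ 6` legs are pairwise within pair angle `Φ₀`, then there are four distinct legs `s, a, b, c ≠ i₁`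
and a shift `σ ∈ {0, π}` with `a, b, c` within torus distance `2Φ₀` of `θ_s + σ` (pigeonhole on the two sides of a reference leg). [folklore] -/
theorem exists_base_triple {L : ℕ} (hL : 6 ≤ L) (i₁ : Fin L) (θ : Fin L → ℝ) {Φ₀ : ℝ} (hΦ₀ : 0 ≤ Φ₀)
    (hnar : ∀ i j : Fin L, i ≠ i₁ → j ≠ i₁ → pairAngle (θ i) (θ j) ≤ Φ₀) :
    ∃ s a b c : Fin L, s ≠ i₁ ∧ a ≠ i₁ ∧ b ≠ i₁ ∧ c ≠ i₁ ∧ s ≠ a ∧ s ≠ b ∧ s ≠ c ∧ a ≠ b ∧ a ≠ c ∧ b ≠ c ∧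
      ∃ σ : ℝ, (σ = 0 ∨ σ = π) ∧ ∀ x ∈ ({a, b, c} : Finset (Fin L)), FermiRG.torusDist (θ x - (θ s + σ)) ≤ 2 * Φ₀ := by
  set F : Finset (Fin L) := Finset.univ.erase i₁ with hF
  have hFcard : F.card = L - 1 := by rw [hF, Finset.card_erase_of_mem (Finset.mem_univ _), Finset.card_univ, Fintype.card_fin]
  have hmemF : ∀ i, i ∈ F ↔ i ≠ i₁ := fun i => by rw [hF]; simp
  have hFne : F.Nonempty := by rw [← Finset.card_pos, hFcard]; omega
  obtain ⟨e, he⟩ := hFne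
  have hei : e ≠ i₁ := (hmemF e).1 he
  set P := F.filter fun i => FermiRG.torusDist (θ i - θ e) ≤ Φ₀ with hP
  set Q := F.filter fun i => ¬ FermiRG.torusDist (θ i - θ e) ≤ Φ₀ with hQ
  have hPQ : P.card + Q.card = L - 1 := by
    rw [hP, hQ, Finset.card_filter_add_card_filter_not, hFcard]
  have hPc : ∀ i ∈ P, FermiRG.torusDist (θ i - θ e) ≤ Φ₀ := fun i hi => (Finset.mem_filter.1 hi).2
  have hQc : ∀ i ∈ Q, FermiRG.torusDist (θ i - (θ e + π)) ≤ Φ₀ := by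
    intro i hi
    obtain ⟨hiF, hnot⟩ := Finset.mem_filter.1 hi
    rcases torusDist_alt_of_pairAngle_le (hnar i e ((hmemF i).1 hiF) hei) with h | h
    · exact absurd h hnot
    · exact h
  have hPF : ∀ i ∈ P, i ≠ i₁ := fun i hi => (hmemF i).1 (Finset.mem_filter.1 hi).1
  have hQF : ∀ i ∈ Q, i ≠ i₁ := fun i hi => (hmemF i).1 (Finset.mem_filter.1 hi).1
  have heP : e ∈ P := by
    rw [hP, Finset.mem_filter]; refine ⟨he, ?_⟩
    rw [sub_self]; unfold FermiRG.torusDist; simpa using hΦ₀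
  have hPQdisj : ∀ i ∈ P, i ∉ Q := fun i hi hiQ => (Finset.mem_filter.1 hiQ).2 (hPc i hi)
  have hQPdisj : ∀ i ∈ Q, i ∉ P := fun i hi hiP => (Finset.mem_filter.1 hi).2 (hPc i hiP)
  -- the conclusion from a base `s`, a set `T` of candidates and a centre
  have hfinish : ∀ (s : Fin L) (T : Finset (Fin L)) (c₀ σ : ℝ), s ≠ i₁ → (∀ i ∈ T, i ≠ i₁) → 2 < T.card →
      (∀ i ∈ T, FermiRG.torusDist (θ i - c₀) ≤ Φ₀) → FermiRG.torusDist (θ s + σ - c₀) ≤ Φ₀ → s ∉ T → (σ = 0 ∨ σ = π) →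
      ∃ s a b c : Fin L, s ≠ i₁ ∧ a ≠ i₁ ∧ b ≠ i₁ ∧ c ≠ i₁ ∧ s ≠ a ∧ s ≠ b ∧ s ≠ c ∧ a ≠ b ∧ a ≠ c ∧ b ≠ c ∧
        ∃ σ : ℝ, (σ = 0 ∨ σ = π) ∧ ∀ x ∈ ({a, b, c} : Finset (Fin L)), FermiRG.torusDist (θ x - (θ s + σ)) ≤ 2 * Φ₀ := by
    intro s T c₀ σ hsi hTi hT hTc hs hsT hσ
    obtain ⟨a, b, c, ha, hb, hc, hsa, hsb, hsc, hab, hac, hbc, hx⟩ := triple_near_base θ hT hTc hs hsT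
    exact ⟨s, a, b, c, hsi, hTi a ha, hTi b hb, hTi c hc, hsa, hsb, hsc, hab, hac, hbc, σ, hσ, hx⟩
  by_cases hP4 : 4 ≤ P.card
  · -- (i) four legs on the side of `e`: base `e`, triple in `P \\ {e}`
    refine hfinish e (P.erase e) (θ e) 0 hei (fun i hi => hPF i (Finset.mem_of_mem_erase hi)) ?_
      (fun i hi => hPc i (Finset.mem_of_mem_erase hi)) ?_ (Finset.notMem_erase e P) (Or.inl rfl)
    · rw [Finset.card_erase_of_mem heP]; omega
    · rw [add_zero, sub_self]; unfold FermiRG.torusDist; simpa using hΦ₀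
  by_cases hQ4 : 4 ≤ Q.card
  · -- (ii) four legs on the far side: base some `s ∈ Q`, triple in `Q \\ {s}`
    have hQne : Q.Nonempty := by rw [← Finset.card_pos]; omega
    obtain ⟨s, hsQ⟩ := hQne
    refine hfinish s (Q.erase s) (θ e + π) 0 (hQF s hsQ) (fun i hi => hQF i (Finset.mem_of_mem_erase hi)) ?_
      (fun i hi => hQc i (Finset.mem_of_mem_erase hi)) ?_ (Finset.notMem_erase s Q) (Or.inl rfl)
    · rw [Finset.card_erase_of_mem hsQ]; omega
    · rw [add_zero]; exact hQc s hsQ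
  by_cases hP3 : P.card = 3
  · -- (iii) exactly three on the side of `e`: base some `s ∈ Q` seen through the shift `π`
    have hQne : Q.Nonempty := by rw [← Finset.card_pos]; omega
    obtain ⟨s, hsQ⟩ := hQne
    refine hfinish s P (θ e) π (hQF s hsQ) hPF (by omega) hPc ?_ (hQPdisj s hsQ) (Or.inr rfl)
    have e1 : θ s + π - θ e = (θ s - (θ e + π)) + (1 : ℤ) * (2 * π) := by push_cast; ring
    rw [e1, PerturbedFermiCurve.torusDist_add_int_mul_two_pi]; exact hQc s hsQ
  · -- (iv) `#P ≤ 2`, hence `#Q = 3`: base `e`, triple `Q`, shift `π`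
    have hQ3 : Q.card = 3 := by omega
    refine hfinish e Q (θ e + π) π hei hQF (by omega) hQc ?_ (hPQdisj e heP) (Or.inr rfl)
    rw [sub_self]; unfold FermiRG.torusDist; simpa using hΦ₀

/-! ## §2 The narrow-bundle count -/

open Classical in
/-- **The narrow-bundle count** (the `(L−3)` law for target strings whose free legs are pairwise within pair angle `Φ₀`): with `T_bound`, `N`, `K₀` as in
`card_narrowClass_le`, `#{ω : ω_{i₁} = ω₁, narrow, Σ k = R with k_i ∈ S_{n′,ω_i}} ≤ 2L⁴ · T_bound · N · K₀^{L−5}`. [cite: BenfattoGiulianiMastropietro2003, §7.4 (s1.21)–(s1.25a) p.28 (L19–52)] -/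
theorem card_narrowStrings_le {ε : (Fin 2 → ℝ) → ℝ} {μ e₀ : ℝ} {u : ℝ → ℝ → ℝ} (hD : DispersionHyp ε μ e₀ u) {c₃ : ℝ} (hc₃ : 0 < c₃)
    (h73 : ∀ (n ω : ℕ), ω < sectorCount n → ∀ p ∈ sSector u e₀ n ω,
      ∃ k₁ k₂ : ℝ,
        p = fermiPoint u (sectorCenter n ω) + k₁ • unitNormal u (sectorCenter n ω) 0 +
              k₂ • unitTangent u (sectorCenter n ω) 0 ∧
        |k₁| ≤ c₃ * (4 : ℝ) ^ (-(n : ℤ)) ∧ |k₂| ≤ c₃ * (2 : ℝ) ^ (-(n : ℤ)) ∧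
        |fderiv ℝ ε p (unitTangent u (sectorCenter n ω) 0)| ≤ c₃ * (2 : ℝ) ^ (-(n : ℤ)))
    {s₁ Φ cf Af Bf M₁ : ℝ} (hs₁ : 0 < s₁) (hM₁ : 0 ≤ M₁) (hΦ : 0 < Φ) (hcf : 0 < cf) (hcfA : cf ≤ Af) (hBf : 0 ≤ Bf)
    (hchart : ∀ θs : ℝ, ∃ f f' f'' : ℝ → ℝ, Measurable f ∧
        (∀ φ ∈ Icc (-Φ) Φ,
          f ((fermiPoint u (θs + φ) - fermiPoint u θs) ⬝ᵥ tdir θs) = -((fermiPoint u (θs + φ) - fermiPoint u θs) ⬝ᵥ dir θs)) ∧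
        (∀ y ∈ Icc (-(s₁ / 4 * Φ)) (s₁ / 4 * Φ), HasDerivAt f (f' y) y ∧ HasDerivAt f' (f'' y) y ∧
          cf ≤ f'' y ∧ f'' y ≤ Af ∧ |f' y| ≤ Bf) ∧
        (∀ φ ∈ Icc (-Φ) Φ, ∀ φ' ∈ Icc (-Φ) Φ,
          s₁ / 2 * |φ - φ'| ≤ |(fermiPoint u (θs + φ) - fermiPoint u θs) ⬝ᵥ tdir θs - (fermiPoint u (θs + φ') - fermiPoint u θs) ⬝ᵥ tdir θs| ∧
          |(fermiPoint u (θs + φ) - fermiPoint u θs) ⬝ᵥ tdir θs - (fermiPoint u (θs + φ') - fermiPoint u θs) ⬝ᵥ tdir θs| ≤ M₁ * |φ - φ'|) ∧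
        (fermiPoint u (θs + 0) - fermiPoint u θs) ⬝ᵥ tdir θs = 0)
    {n' L : ℕ} (hL : 6 ≤ L) (i₁ : Fin L) (ω₁ : ℕ) (R : Fin 2 → ℝ) {Φ₀ : ℝ} (hΦ₀ : 0 ≤ Φ₀) (h2Φ₀ : 2 * Φ₀ ≤ Φ)
    (hreg : 6 * (M₁ * (2 * Φ₀)) + 3 * (L * (4 * c₃ * (2 : ℝ) ^ (-(n' : ℤ)))) + 2 * (s₁ / 2 * sectorWidth n') ≤ s₁ / 4 * Φ) :
    ((((Finset.univ : Finset (Fin L → Fin (sectorCount n'))).filter fun ω =>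
        (ω i₁ : ℕ) = ω₁ ∧ (∀ i j : Fin L, i ≠ i₁ → j ≠ i₁ → pairAngle (sectorCenter n' (ω i)) (sectorCenter n' (ω j)) ≤ Φ₀) ∧
        ∃ k : Fin L → (Fin 2 → ℝ), (∀ i, k i ∈ sSector u e₀ n' (ω i : ℕ)) ∧ ∑ i, k i = R).card : ℝ)) ≤
      2 * (L : ℝ) ^ 4 *
      ((2 * (L * (4 * c₃ * (2 : ℝ) ^ (-(n' : ℤ)))) / (s₁ / 2 * sectorWidth n') + 1) *
        (960 * Af * (2 * (L * (4 * c₃ * (2 : ℝ) ^ (-(n' : ℤ))) + Bf * (L * (4 * c₃ * (2 : ℝ) ^ (-(n' : ℤ))))) +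
          (4 * Bf + 1) * (s₁ / 2 * sectorWidth n')) / cf ^ 2 / (s₁ / 2 * sectorWidth n') ^ 2) *
      ((sectorCount n' : ℝ) * (2 * (2 * Φ₀ / sectorWidth n' + 1)) ^ (L - 5))) := by
  set Nar := (Finset.univ : Finset (Fin L → Fin (sectorCount n'))).filter fun ω =>
        (ω i₁ : ℕ) = ω₁ ∧ (∀ i j : Fin L, i ≠ i₁ → j ≠ i₁ → pairAngle (sectorCenter n' (ω i)) (sectorCenter n' (ω j)) ≤ Φ₀) ∧
        ∃ k : Fin L → (Fin 2 → ℝ), (∀ i, k i ∈ sSector u e₀ n' (ω i : ℕ)) ∧ ∑ i, k i = R with hNar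
  set Bnd : ℝ := (2 * (L * (4 * c₃ * (2 : ℝ) ^ (-(n' : ℤ)))) / (s₁ / 2 * sectorWidth n') + 1) *
        (960 * Af * (2 * (L * (4 * c₃ * (2 : ℝ) ^ (-(n' : ℤ))) + Bf * (L * (4 * c₃ * (2 : ℝ) ^ (-(n' : ℤ))))) +
          (4 * Bf + 1) * (s₁ / 2 * sectorWidth n')) / cf ^ 2 / (s₁ / 2 * sectorWidth n') ^ 2) *
      ((sectorCount n' : ℝ) * (2 * (2 * Φ₀ / sectorWidth n' + 1)) ^ (L - 5)) with hBnd
  have hw := sectorWidth_pos n'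
  have hAf : 0 < Af := hcf.trans_le hcfA
  have hBnd0 : 0 ≤ Bnd := by rw [hBnd]; positivity
  -- the classes, indexed by ordered quadruples `(((s, a), b), c)` and a shift
  set Cl : (((Fin L × Fin L) × Fin L) × Fin L) → ℝ → Finset (Fin L → Fin (sectorCount n')) := fun q σ =>
    (Finset.univ : Finset (Fin L → Fin (sectorCount n'))).filter fun ω =>
        (ω i₁ : ℕ) = ω₁ ∧ (∀ i j : Fin L, i ≠ i₁ → j ≠ i₁ → pairAngle (sectorCenter n' (ω i)) (sectorCenter n' (ω j)) ≤ Φ₀) ∧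
        (∀ x ∈ ({q.1.1.2, q.1.2, q.2} : Finset (Fin L)), FermiRG.torusDist (sectorCenter n' (ω x) - (sectorCenter n' (ω q.1.1.1) + σ)) ≤ 2 * Φ₀) ∧
        ∃ k : Fin L → (Fin 2 → ℝ), (∀ i, k i ∈ sSector u e₀ n' (ω i : ℕ)) ∧ ∑ i, k i = R with hCl
  set Quads := (Finset.univ : Finset (((Fin L × Fin L) × Fin L) × Fin L)).filter fun q =>
      q.1.1.1 ≠ i₁ ∧ q.1.1.2 ≠ i₁ ∧ q.1.2 ≠ i₁ ∧ q.2 ≠ i₁ ∧ q.1.1.1 ≠ q.1.1.2 ∧ q.1.1.1 ≠ q.1.2 ∧ q.1.1.1 ≠ q.2 ∧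
        q.1.1.2 ≠ q.1.2 ∧ q.1.1.2 ≠ q.2 ∧ q.1.2 ≠ q.2 with hQuads
  -- the bound for one class
  have hclass : ∀ q ∈ Quads, ∀ σ : ℝ, ((Cl q σ).card : ℝ) ≤ Bnd := by
    intro q hq σ
    rw [hQuads, Finset.mem_filter] at hq
    obtain ⟨-, hs, ha, hb, hc, hsa, hsb, hsc, hab, hac, hbc⟩ := hq
    have h := card_narrowClass_le hD hc₃ h73 hs₁ hM₁ hΦ hcf hcfA hBf hchart i₁ q.1.1.1 q.1.1.2 q.1.2 q.2
      ha.symm hb.symm hc.symm hs.symm hsa hsb hsc hab hac hbc ω₁ R hΦ₀ h2Φ₀ σ hreg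
    rw [hCl, hBnd]
    exact h
  -- coverage
  have hcover : Nar ⊆ Quads.biUnion fun q => Cl q 0 ∪ Cl q π := by
    intro ω hω
    rw [hNar, Finset.mem_filter] at hω
    obtain ⟨-, hω₁, hnar, hk⟩ := hω
    obtain ⟨s, a, b, c, hs, ha, hb, hc, hsa, hsb, hsc, hab, hac, hbc, σ, hσ, hx⟩ :=
      exists_base_triple hL i₁ (fun i => sectorCenter n' (ω i)) hΦ₀ hnar
    rw [Finset.mem_biUnion]
    refine ⟨(((s, a), b), c), ?_, ?_⟩
    · rw [hQuads, Finset.mem_filter]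
      exact ⟨Finset.mem_univ _, hs, ha, hb, hc, hsa, hsb, hsc, hab, hac, hbc⟩
    · rw [Finset.mem_union]
      rcases hσ with rfl | rfl
      · left; rw [hCl, Finset.mem_filter]; exact ⟨Finset.mem_univ _, hω₁, hnar, hx, hk⟩
      · right; rw [hCl, Finset.mem_filter]; exact ⟨Finset.mem_univ _, hω₁, hnar, hx, hk⟩
  -- summation
  have hQcard : (Quads.card : ℝ) ≤ (L : ℝ) ^ 4 := by
    have h1 : Quads.card ≤ (Finset.univ : Finset (((Fin L × Fin L) × Fin L) × Fin L)).card := Finset.card_le_card (Finset.filter_subset _ _)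
    rw [Finset.card_univ, Fintype.card_prod, Fintype.card_prod, Fintype.card_prod, Fintype.card_fin] at h1
    have h2 : (Quads.card : ℝ) ≤ ((L * L * L * L : ℕ) : ℝ) := by exact_mod_cast h1
    refine h2.trans_eq ?_
    push_cast; ring
  calc (Nar.card : ℝ) ≤ ((Quads.biUnion fun q => Cl q 0 ∪ Cl q π).card : ℝ) := by exact_mod_cast Finset.card_le_card hcover
    _ ≤ ∑ q ∈ Quads, ((Cl q 0 ∪ Cl q π).card : ℝ) := by exact_mod_cast Finset.card_biUnion_le
    _ ≤ ∑ q ∈ Quads, (Bnd + Bnd) := by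
        refine Finset.sum_le_sum fun q hq => ?_
        calc ((Cl q 0 ∪ Cl q π).card : ℝ) ≤ ((Cl q 0).card : ℝ) + ((Cl q π).card : ℝ) := by
              exact_mod_cast Finset.card_union_le _ _
          _ ≤ Bnd + Bnd := add_le_add (hclass q hq 0) (hclass q hq π)
    _ = Quads.card * (2 * Bnd) := by rw [Finset.sum_const, nsmul_eq_mul]; ring
    _ ≤ (L : ℝ) ^ 4 * (2 * Bnd) := mul_le_mul_of_nonneg_right hQcard (by positivity)
    _ = 2 * (L : ℝ) ^ 4 * Bnd := by ring

end Summit.HubbardSuperconductivity.HubbardSuperconductivity.Theorems.AbsUmklappCount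

end
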